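import Literature.NumberTheory.EllipticCurves.SkinnerUrban2014.CofinitelyGeneratedSelmerProofs
import Literature.NumberTheory.EllipticCurves.IwasawaAlgebraPseudoNullProofs
import Literature.Algebra.Module.CompleteNakayama
import Mathlib.RingTheory.QuotSMulTop
import HarnessLib

/-!
# Two-variable CONTROL ([JSW17, Lemma 3.4.1]), Pontryagin-dual side: from an injective
# `C`-semilinear `θ : N₁ ↪ N₂` onto the `r`-torsion to `N₂^∨/r ≅ N₁^∨`, and finite generation of
# `N₂^∨` by the complete Nakayama lemma (helper, `--supports stmt-BirchSwinnertonDyer-25505`)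

Cell `bsd-stepL`, seat `bsd-stepL-imc-p1` (prover g21, 2026-08-28). Theorems only (no definition, no
named fact, no `sorry`, no instance, no notation). Fifth file of the `complete` cut of crux 25505
`ErratumThm23SigmaLe` along the line `erratum_chain`; PURE ALGEBRA, stated for abstract data so that
the instantiation (`ErratumRoadFiveTwoVariableControl.lean`: `N₁ = Sel_L(M)` a `Λ`-module,
`N₂ = Sel_L(𝓜)` a `Λ⟦X⟧`-module, `C = PowerSeries.C`, `r = X`, `θ` of
`ErratumRoadFiveTwoVariableControlHom.lean`) is a one-line application.

## What is proved

Data: rings `R`, `S`, a ring map `C : R →+* S`, `r ∈ S`, an `R`-module `N₁`, an `S`-module `N₂`,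
an additive `θ : N₁ → N₂` with `θ (a • n) = C a • θ n`, `r • θ n = 0`, `θ` injective, and every
`y ∈ N₂` with `r • y = 0` in the range of `θ` (i.e. `θ : N₁ ≅ N₂[r]` semilinearly). Write
`Nᵢ^∨ = CharacterModule Nᵢ = Hom(Nᵢ, ℚ/ℤ)` (Pontryagin duals, `S`- resp. `R`-modules by
precomposition) and `N₂^∨/r = QuotSMulTop r N₂^∨`, an `R`-module through `C` (`Module.compHom`).

* `exists_quotSMulTop_linearMap` — **`θ^∨ : N₂^∨/r N₂^∨ ⥲ N₁^∨`**: there is an `R`-linear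
  `f : N₂^∨/r → N₁^∨` with `f [χ] = χ ∘ θ`, SURJECTIVE (a character of `N₁` extends along the
  injection `θ`, `ℚ/ℤ` being divisible: Mathlib `CharacterModule.dual_surjective_of_injective`) and
  with KERNEL `⊥` (a character of `N₂` killing `θ(N₁) = N₂[r]` is an `r`-multiple:
  `SkinnerUrban2014.exists_smul_eq_of_forall_apply_eq_zero`, "factor through `N/N[r] ≅ rN` and
  extend"). This is the dual map "`X(𝓜)/(γ₊ − 1)X(𝓜) → X(M)`" of [JSW17, (before Lemma 3.4.1)] in
  the exact case (trivial control defect), where it is an ISOMORPHISM.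
* `isPseudoNull_ker` — its kernel is pseudo-null (it is zero).
* `module_finite_characterModule` — **finite generation transfers**: if moreover `S` is
  `(r)`-adically (pre)complete, every element of `N₂` is killed by a power of `r`, and `N₁^∨` is a
  finitely generated `R`-module, then `N₂^∨` is a finitely generated `S`-module. Proof: `N₂^∨` is
  `(r)`-adically separated (an `x ∈ rⁿ N₂^∨` kills `N₂[rⁿ]`, and `N₂ = ⋃ N₂[rⁿ]`), `N₂^∨/r ≅ N₁^∨`
  is finitely generated, and the tree's complete Nakayama
  `Literature.Algebra.Module.finite_of_isHausdorff_of_forall_mem_sup` ([Matsumura1987] Thm. 8.4)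
  lifts generators. For `S = Λ⟦X⟧` (Mathlib: `IsAdicComplete (X) R⟦X⟧`) this is "[`X^Σ_{Gr}(𝓜)`]
  is a finite `Λ_K`-module" of [JSW17, §3.4] from the one-variable finiteness [SU14, Lemma 3.1.9]
  (tree: `SkinnerUrban2014.moduleFinite_XBig`).

HONEST FRAMING: module algebra; nothing about any newform or curve is asserted; BSD is proved for no
pair; closes: none (T7).

## References
* [JetchevSkinnerWan2017] §3.4, display before Lemma 3.4.1 and Lemma 3.4.1 (arXiv:1512.06894 p. 14).
* [GreenbergLNM1716] §4, proof of Prop. 4.10 (dualising `0 → 𝒜[θ] → 𝒜 → 𝒜 → 0`);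
  [Washington1997] Lemma 13.16 (`X/TX` for a Pontryagin dual `X`).
* [Matsumura1987] Theorem 8.4 (Nakayama for separated modules over complete rings).
-/

noncomputable section

-- D-0017: single-problem summit, the namespace repeats the problem name by design.
set_option linter.dupNamespace false
set_option autoImplicit false

namespace Summit.BirchSwinnertonDyer.BirchSwinnertonDyer.Theorems.ErratumThm23TwoVariable.ControlDual

open Literature.NumberTheory.EllipticCurves
open scoped Pointwise

variable {R S : Type*} [CommRing R] [CommRing S] (C : R →+* S) (r : S)
  {N₁ N₂ : Type*} [AddCommGroup N₁] [Module R N₁] [AddCommGroup N₂] [Module S N₂]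
  (θ : N₁ →+ N₂)

/-- **Pontryagin dual of the control injection: `N₂^∨/r N₂^∨ ⥲ N₁^∨`.** For an additive, injective,
`C`-semilinear `θ : N₁ → N₂` with `r • θ = 0` whose range contains `N₂[r]`, there is an `R`-linear map
`f : QuotSMulTop r (CharacterModule N₂) → CharacterModule N₁` (the quotient an `R`-module through `C`)
with `f [χ] = χ ∘ θ`, which is SURJECTIVE and has KERNEL `⊥` — the map
"`X(𝓜)/(γ₊ − 1)X(𝓜) → X(M)`" of [JSW17], an isomorphism when the control defect vanishes.
[cite: JetchevSkinnerWan2017, §3.4, display before Lemma 3.4.1 and Lemma 3.4.1 (arXiv:1512.06894 p. 14)]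
[cite: Washington1997, Lemma 13.16 (X/TX for the Pontryagin dual X)] -/
theorem exists_quotSMulTop_linearMap
    (hθC : ∀ (a : R) (n : N₁), θ (a • n) = C a • θ n) (hθr : ∀ n : N₁, r • θ n = 0)
    (hinj : Function.Injective θ) (hsurj : ∀ y : N₂, r • y = 0 → y ∈ Set.range θ) :
    ∃ f : (letI : Module R (QuotSMulTop r (CharacterModule N₂)) := Module.compHom _ C
          QuotSMulTop r (CharacterModule N₂) →ₗ[R] CharacterModule N₁),
      Function.Surjective f ∧
      (∀ χ : CharacterModule N₂, f (Submodule.Quotient.mk χ) = χ.comp θ) ∧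
      (letI : Module R (QuotSMulTop r (CharacterModule N₂)) := Module.compHom _ C
       LinearMap.ker f = ⊥) := by
  letI : Module R (QuotSMulTop r (CharacterModule N₂)) := Module.compHom _ C
  -- the dual `χ ↦ χ ∘ θ` kills `r • N₂^∨`
  let f₀ : CharacterModule N₂ →+ CharacterModule N₁ :=
    { toFun := fun χ ↦ χ.comp θ
      map_zero' := rfl
      map_add' := fun _ _ ↦ rfl }
  have hf₀ : ∀ χ ∈ (r • (⊤ : Submodule S (CharacterModule N₂))).toAddSubgroup, f₀ χ = 0 := by
    intro χ hχ
    rw [Submodule.mem_toAddSubgroup, Submodule.mem_smul_pointwise_iff_exists] at hχ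
    obtain ⟨ψ, -, rfl⟩ := hχ
    ext n
    change (r • ψ) (θ n) = 0
    rw [CharacterModule.smul_apply, hθr, map_zero]
  let f₁ : QuotSMulTop r (CharacterModule N₂) →+ CharacterModule N₁ :=
    QuotientAddGroup.lift _ f₀ hf₀
  have hf₁ : ∀ χ : CharacterModule N₂, f₁ (Submodule.Quotient.mk χ) = χ.comp θ := fun _ ↦ rfl
  -- `R`-linearity through `C`: `(C a • χ) ∘ θ = χ ∘ θ ∘ (a • ·)`
  let f : QuotSMulTop r (CharacterModule N₂) →ₗ[R] CharacterModule N₁ :=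
    { toFun := f₁
      map_add' := map_add f₁
      map_smul' := fun a q ↦ by
        induction q using Submodule.Quotient.induction_on with
        | H χ =>
          change f₁ (Submodule.Quotient.mk (C a • χ)) = a • f₁ (Submodule.Quotient.mk χ)
          rw [hf₁, hf₁]
          ext n
          change (C a • χ) (θ n) = χ (θ (a • n))
          rw [CharacterModule.smul_apply, hθC] }
  have hf : ∀ χ : CharacterModule N₂, f (Submodule.Quotient.mk χ) = χ.comp θ := hf₁
  refine ⟨f, ?_, hf, ?_⟩
  · -- surjective: extend `ψ ∘ θ⁻¹` along the injection `θ` (`ℚ/ℤ` is divisible)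
    intro ψ
    obtain ⟨χ, hχ⟩ := CharacterModule.dual_surjective_of_injective θ.toIntLinearMap hinj ψ
    exact ⟨Submodule.Quotient.mk χ, by rw [hf]; exact hχ⟩
  · -- kernel: a character killing `θ(N₁) ⊇ N₂[r]` is an `r`-multiple
    refine (Submodule.eq_bot_iff _).2 fun q hq ↦ ?_
    induction q using Submodule.Quotient.induction_on with
    | H χ =>
      rw [LinearMap.mem_ker, hf] at hq
      have hkill : ∀ y : N₂, r • y = 0 → χ y = 0 := by
        intro y hy
        obtain ⟨n, rfl⟩ := hsurj y hy
        exact DFunLike.congr_fun hq n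
      obtain ⟨ψ, hψ⟩ := SkinnerUrban2014.exists_smul_eq_of_forall_apply_eq_zero r χ hkill
      exact (Submodule.Quotient.mk_eq_zero _).2
        ((Submodule.mem_smul_pointwise_iff_exists _ _ _).2 ⟨ψ, Submodule.mem_top, hψ⟩)

/-- **The kernel of `N₂^∨/r → N₁^∨` is pseudo-null** (it is zero): the conclusion shape asked by the
descent algebra `TwoVariableDescent.charIdeal_le_map_constantCoeff_of_control` ∕ the stub
`stub_control` of line `erratum_chain` ("finite kernel", [JSW17, Lemma 3.4.1], in the exact case).
[cite: JetchevSkinnerWan2017, Lemma 3.4.1 (arXiv:1512.06894 p. 14)] -/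
theorem isPseudoNull_ker
    (hθC : ∀ (a : R) (n : N₁), θ (a • n) = C a • θ n) (hθr : ∀ n : N₁, r • θ n = 0)
    (hinj : Function.Injective θ) (hsurj : ∀ y : N₂, r • y = 0 → y ∈ Set.range θ) :
    ∃ f : (letI : Module R (QuotSMulTop r (CharacterModule N₂)) := Module.compHom _ C
          QuotSMulTop r (CharacterModule N₂) →ₗ[R] CharacterModule N₁),
      Function.Surjective f ∧
      (∀ χ : CharacterModule N₂, f (Submodule.Quotient.mk χ) = χ.comp θ) ∧
      (letI : Module R (QuotSMulTop r (CharacterModule N₂)) := Module.compHom _ C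
       Module.IsPseudoNull R (LinearMap.ker f)) := by
  letI : Module R (QuotSMulTop r (CharacterModule N₂)) := Module.compHom _ C
  obtain ⟨f, hfs, hf, hker⟩ := exists_quotSMulTop_linearMap C r θ hθC hθr hinj hsurj
  refine ⟨f, hfs, hf, ?_⟩
  haveI : Subsingleton (LinearMap.ker f) := by
    rw [hker]
    infer_instance
  exact Module.isPseudoNull_of_subsingleton R _

/-- **Finite generation of `N₂^∨` over `S` from that of `N₁^∨` over `R`**, when `S` is
`(r)`-adically (pre)complete and `N₂` is `r`-power torsion: `N₂^∨` is `(r)`-separated (an element of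
`rⁿ N₂^∨` kills `N₂[rⁿ]`), `N₂^∨/r ≅ N₁^∨` is finitely generated, and the complete Nakayama lemma
lifts generators. With `S = Λ⟦X⟧`, `r = X`: "`X^Σ_{Gr}(𝓜)` … is a finite `Λ_K`-module" [JSW17, §3.4]
from the one-variable finiteness [SU14, Lemma 3.1.9].
[cite: JetchevSkinnerWan2017, §3.4 (arXiv:1512.06894 p. 14, "a finite Λ_K-module")]
[cite: Matsumura1987, Theorem 8.4] -/
theorem module_finite_characterModule [IsPrecomplete (Ideal.span {r}) S]
    (hθC : ∀ (a : R) (n : N₁), θ (a • n) = C a • θ n) (hθr : ∀ n : N₁, r • θ n = 0)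
    (hinj : Function.Injective θ) (hsurj : ∀ y : N₂, r • y = 0 → y ∈ Set.range θ)
    (htors : ∀ y : N₂, ∃ n : ℕ, r ^ n • y = 0)
    [Module.Finite R (CharacterModule N₁)] :
    Module.Finite S (CharacterModule N₂) := by
  classical
  -- `(r)`-adic separatedness of `N₂^∨`
  haveI : IsHausdorff (Ideal.span {r}) (CharacterModule N₂) := by
    refine ⟨fun x hx ↦ ?_⟩
    ext y
    obtain ⟨n, hn⟩ := htors y
    have hxn := hx n
    rw [SModEq.zero, Ideal.span_singleton_pow, Submodule.ideal_span_singleton_smul,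
      Submodule.mem_smul_pointwise_iff_exists] at hxn
    obtain ⟨z, -, rfl⟩ := hxn
    rw [CharacterModule.smul_apply, hn, map_zero]
    rfl
  -- `N₂^∨/r ≅ N₁^∨`
  obtain ⟨f, hfs, hf, hker⟩ := exists_quotSMulTop_linearMap C r θ hθC hθr hinj hsurj
  letI : Module R (QuotSMulTop r (CharacterModule N₂)) := Module.compHom _ C
  obtain ⟨t, ht⟩ := Module.Finite.fg_top (R := R) (M := CharacterModule N₁)
  -- lift each generator through the surjection `f ∘ mk`
  have hlift : ∀ x : CharacterModule N₁, ∃ χ : CharacterModule N₂,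
      f (Submodule.Quotient.mk χ) = x := by
    intro x
    obtain ⟨q, hq⟩ := hfs x
    induction q using Submodule.Quotient.induction_on with
    | H χ => exact ⟨χ, hq⟩
  choose lift hlift using hlift
  refine Literature.Algebra.Module.finite_of_isHausdorff_of_forall_mem_sup (Ideal.span {r})
    (fun i : t ↦ lift (i : CharacterModule N₁)) fun m ↦ ?_
  -- write `f [m]` on the generators and lift the combination
  have hm : f (Submodule.Quotient.mk m) ∈ Submodule.span R (t : Set (CharacterModule N₁)) := by
    rw [ht]; exact Submodule.mem_top
  obtain ⟨c, hc⟩ := Submodule.mem_span_finset'.1 hm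
  set m₀ : CharacterModule N₂ := ∑ a : t, C (c a) • lift (a : CharacterModule N₁) with hm₀
  have hm₀mem : m₀ ∈ Submodule.span S (Set.range fun i : t ↦ lift (i : CharacterModule N₁)) :=
    Submodule.sum_mem _ fun a _ ↦ Submodule.smul_mem _ _ (Submodule.subset_span ⟨a, rfl⟩)
  have hfm₀ : f (Submodule.Quotient.mk m₀) = f (Submodule.Quotient.mk m) := by
    rw [← hc, hm₀]
    rw [← Submodule.mkQ_apply, map_sum, map_sum]
    refine Finset.sum_congr rfl fun a _ ↦ ?_
    rw [Submodule.mkQ_apply, Submodule.Quotient.mk_smul]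
    have e := f.map_smul (c a) (Submodule.Quotient.mk (lift (a : CharacterModule N₁)))
    rw [hlift] at e
    exact e
  -- `[m] = [m₀]` by injectivity, i.e. `m - m₀ ∈ r • N₂^∨`
  have hdiff : Submodule.Quotient.mk (p := r • (⊤ : Submodule S (CharacterModule N₂))) (m - m₀) = 0 := by
    have hk : Submodule.Quotient.mk (p := r • (⊤ : Submodule S (CharacterModule N₂))) (m - m₀) ∈
        LinearMap.ker f := by
      rw [LinearMap.mem_ker, Submodule.Quotient.mk_sub, map_sub, hfm₀, sub_self]
    rw [hker] at hk
    exact (Submodule.mem_bot _).1 hk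
  rw [Submodule.Quotient.mk_eq_zero] at hdiff
  rw [Submodule.ideal_span_singleton_smul]
  exact Submodule.mem_sup.2 ⟨m₀, hm₀mem, m - m₀, hdiff, add_sub_cancel m₀ m⟩

end Summit.BirchSwinnertonDyer.BirchSwinnertonDyer.Theorems.ErratumThm23TwoVariable.ControlDual

end
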